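import Summits.AtomisticToContinuum.HydrodynamicLimit.Theses.RingDensityCertificate

/-!
# Birth skeleton (BC3) for crux `RingDensityCertificate.RingCertificate`
(item stmt-AtomisticToContinuum-12128, rank 4; route `route-AtomisticToContinuum-RingDensityCertificate`,
sub-problem `HydrodynamicLimit`; registered as `Cruxes/RingCertificate/Lines/birth.lean`)

The crux is the certificate implication
`RingCertificate : RingSparsity → RingDensityLaw → ContactChaos` — in the sparse regime, equality of
the window ring fraction with its equilibrium value forces the empirical Enskog Stosszahlansatz
(SEL/ANG + RATE) along the local-Gibbs-started flow.

## The cut (three named stubs + kernel-checked composition)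

Reading the three route decls side by side exposes the two seams any proof of the crux must cross:

* `ContactChaos` asks for chaos at EVERY `t ∈ [0, T)`, including the initial layer `t = 0`
  (window `[0, w_N]`), whereas both certificate inputs `RingSparsity` / `RingDensityLaw` only speak
  about `t ∈ (0, T)`.  So the `t = 0` layer has to come from the local Gibbs structure of the data
  alone — stub **S1 `stub_initialLayerChaos : InitialLayerChaos`** (equilibrium technology:
  near-stationarity of the local Gibbs law over `M` kinetic units, Bogolyubov's collision-measure
  identity, the contact-value/virial theorem `g(σ⁺) = (Z(η) − 1)/((2π/3)η)` for the RATE clause,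
  cellwise LLN; size L).
* For `t ∈ (0, T)` the certificate proper is LOCAL and comes with a modulus: for every accuracy
  `δ` there is a ring tolerance `κ(δ) > 0` such that ring-normality at tolerance `κ` on all small
  cells around time `t` (exactly the local conclusion of `RingDensityLaw`, for every comparison
  flow family `Ψ`) forces `δ`-chaos on all small cells.  This is the Chung–Graham–Wilson-type
  rigidity ("normal short-cycle density ⇒ uniform edge statistics") for time-ordered collision
  forests, split along the two physically distinct clauses of the target:
  **S2 `stub_selAngRigidity : RingSparsity → SelAngRigidity`** (velocity–angle factorisation at
  contact, the SEL/ANG clause; HARDEST — carries the crux's own risk: a velocity-correlated but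
  ring-normal state, e.g. shear-aligned pairs, would make the certificate blind) and
  **S3 `stub_rateRigidity : RingSparsity → RateRigidity`** (the Enskog collision frequency with the
  local-equilibrium contact factor `g_E(n_cell σ³)`, the RATE clause: ring-normality certifies the
  contact value of the pair correlation; size XL).  Both consume `RingSparsity` (tree-likeness is the
  regime in which cycle counting constrains edge statistics, ChungGraham2002 sparse quasi-randomness).

Composition: `RingCertificate_of_stubs : InitialLayerChaos → (RingSparsity → SelAngRigidity) →
(RingSparsity → RateRigidity) → (RingSparsity → RingDensityLaw → ContactChaos)` (the real proof, sorry-free,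
conclusion = `RingCertificate` unfolded) and the registered skeleton theorem
`RingCertificate_of : RingCertificate := RingCertificate_of_stubs stub_initialLayerChaos
stub_selAngRigidity stub_rateRigidity` (crux BY NAME, no `sorry` of its own): thresholds `η₀`, `σ₀` are minima of
the four suppliers' (S1, S2, S3, `RingDensityLaw`); at `t = 0` use S1 (`zero_add` normalises the
window `[0, 0 + w_N]`); at `t > 0` feed `RingDensityLaw`'s local conclusion at tolerance `κ₂(δ)`,
`κ₃(δ)` into S2, S3 and intersect the two cell-size thresholds.

No stub restates the crux or the Statement: S1 is the `t = 0` slice only; S2/S3 are cellwise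
statements with an explicit tolerance modulus, each delivering ONE clause of `ContactChaos` and only
for `t > 0` (BC3 probes `stub → RingCertificate`, `stub → _root_.HydrodynamicLimit` by
`first | exact? | simpa | aesop` fail for all three; probe record in `Lines/birth.md`).  All `let`-blocks are
verbatim those of `ContactChaos` / `RingDensityLaw` (same cell, window, ring indicator, `r_E(N)`).

Disproof used: none (no `Cruxes/RingCertificate/Disproof.lean` exists at registration time,
2026-08-17).  Sources: ChungGrahamWilson1989 Thm 1; ChungGraham2002; doi:10.1002/jgt.21701;
AokiEtAl2015 §1 (backward clusters); Bogolyubov1975; VanbeijerenErnst1973; Lutsko1996.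
-/

namespace Summit.AtomisticToContinuum.HydrodynamicLimit.Cruxes.RingCertificate.Birth

open scoped BigOperators Topology Manifold Classical MeasureTheory ProbabilityTheory Matrix InnerProductSpace ComplexConjugate ContinuousMap
open Filter Set Function TopologicalSpace MeasureTheory
open Summit.AtomisticToContinuum.HydrodynamicLimit.Theses.RingDensityCertificate

/-- **Initial-layer contact chaos** (the `t = 0` slice of `ContactChaos`, which neither
`RingSparsity` nor `RingDensityLaw` addresses): for the local-Gibbs-started flow, in cells
`B(x₀, h)` and the FIRST window `[0, w_N]` (`M` local kinetic units at the initial Euler state),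
the collision-sampled average of every continuous `|F| ≤ 1` of (incoming velocities, contact
direction) matches the flux-biased all-pairs average of the same microstate (SEL/ANG), and the
collision count matches the Enskog prediction with contact factor `g_E(n_cell σ³)` (RATE), in
probability as `N → ∞`.  Same prefix as `ContactChaos`; `0 < T` replaces `t ∈ [0, T)`. -/
def InitialLayerChaos : Prop :=
  ∃ η₀ : ℝ, 0 < η₀ ∧ ∀ (a₀ θ₀ : UnitAddTorus (Fin 3) → ℝ) (u₀ : UnitAddTorus (Fin 3) → EuclideanSpace ℝ (Fin 3)), Continuous a₀ → Continuous θ₀ → Continuous u₀ → (∀ x, 0 < a₀ x) → (∀ x, 0 < θ₀ x) → ∃ σ₀ : ℝ, 0 < σ₀ ∧ ∀ σ : ℝ, 0 < σ → σ < σ₀ → ∀ M : ℝ, 0 < M → ∀ (T : ℝ) (ρ θ : ℝ → UnitAddTorus (Fin 3) → ℝ) (u : ℝ → UnitAddTorus (Fin 3) → EuclideanSpace ℝ (Fin 3)), Literature.MathematicalPhysics.KineticTheory.IsHardSphereEulerSolution σ T ρ u θ → (∀ t ∈ Set.Ico 0 T, ∀ x, ρ t x * σ ^ 3 < η₀) →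 ∀ Φ : (N : ℕ) → Literature.Analysis.FluidPDE.HardSphereFlow (Literature.Analysis.FluidPDE.Torus.geometry (Fin 3)) (Literature.MathematicalPhysics.KineticTheory.hsDiameter σ N) (N + 1), Literature.MathematicalPhysics.KineticTheory.TendstoHydroFieldsAt (fun N => Literature.MathematicalPhysics.KineticTheory.localGibbsLaw σ a₀ u₀ θ₀ N (Φ N)) Φ ρ u θ 0 → 0 < T → ∀ δ : ℝ, 0 < δ → ∃ h₀ : ℝ, 0 < h₀ ∧ ∀ h : ℝ, 0 < h → h < h₀ → ∀ x₀ : UnitAddTorus (Fin 3), ∀ F : EuclideanSpace ℝ (Fin 3) → EuclideanSpace ℝ (Fin 3) → EuclideanSpace ℝ (Fin 3) → ℝ, Continuous (fun p : EuclideanSpace ℝ (Fin 3) × EuclideanSpace ℝ (Fin 3) × EuclideanSpace ℝ (Fin 3) => F p.1 p.2.1 p.2.2) → (∀ v v' ω, |F v v' ω| ≤ 1) → let w : ℕ → ℝ := fun N => M / (σ ^ 2 * (ρ 0 x₀ * Real.sqrt (θ 0 x₀) * ((N + 1 : ℕ) : ℝ) ^ (1 / 3 : ℝ))); let Sc :=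 fun (N : ℕ) (z : Literature.Analysis.FluidPDE.Config (N + 1) (Fin 3) (UnitAddTorus (Fin 3))) (E : EuclideanSpace ℝ (Fin 3) → EuclideanSpace ℝ (Fin 3) → EuclideanSpace ℝ (Fin 3) → ℝ) => ∑ i : Fin (N + 1), ∑ j : Fin (N + 1), if i ≠ j then ∑ᶠ s ∈ {s : ℝ | s ∈ Set.Icc 0 (w N) ∧ (Φ N).flow s z ∈ Literature.Analysis.FluidPDE.contactSet (Literature.Analysis.FluidPDE.Torus.geometry (Fin 3)) (N + 1) (Literature.MathematicalPhysics.KineticTheory.hsDiameter σ N) i j ∧ Literature.Analysis.FluidPDE.Torus.euclidDist ((Φ N).flow s z i).1 x₀ < h}, E (Function.leftLim (fun s => (Φ N).flow s z) s i).2 (Function.leftLim (fun s => (Φ N).flow s z) s j).2 ((Literature.MathematicalPhysics.KineticTheory.hsDiameter σ N)⁻¹ • (Literature.Analysis.FluidPDE.Torus.geometry (Fin 3)).sepVec ((Φ N).flow s z i).1 ((Φ N).flow s z j).1) else 0; let Sr := fun (N : ℕ) (z : Literature.Analysis.FluidPDE.Config (N + 1) (Fin 3) (UnitAddTorus (Fin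 3))) (E : EuclideanSpace ℝ (Fin 3) → EuclideanSpace ℝ (Fin 3) → EuclideanSpace ℝ (Fin 3) → ℝ) => ∑ i : Fin (N + 1), ∑ j : Fin (N + 1), if i ≠ j ∧ Literature.Analysis.FluidPDE.Torus.euclidDist ((Φ N).flow 0 z i).1 x₀ < h ∧ Literature.Analysis.FluidPDE.Torus.euclidDist ((Φ N).flow 0 z j).1 x₀ < h then ∫ y : EuclideanSpace ℝ (Fin 3), E ((Φ N).flow 0 z i).2 ((Φ N).flow 0 z j).2 (‖y‖⁻¹ • y) * max 0 (-(inner ℝ (((Φ N).flow 0 z i).2 - ((Φ N).flow 0 z j).2) y)) * Real.exp (-‖y‖ ^ 2) else 0; let nl := fun (N : ℕ) (z : Literature.Analysis.FluidPDE.Config (N + 1) (Fin 3) (UnitAddTorus (Fin 3))) => (∑ i : Fin (N + 1), if Literature.Analysis.FluidPDE.Torus.euclidDist ((Φ N).flow 0 z i).1 x₀ < h then (1 : ℝ) else 0) / ((N + 1 : ℝ) * (4 / 3 * Real.pi * h ^ 3)); let Pr := fun (N : ℕ) (z : Literature.Analysis.FluidPDE.Config (N + 1) (Fin 3) (UnitAddTorus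 (Fin 3))) => ∑ i : Fin (N + 1), ∑ j : Fin (N + 1), if i ≠ j ∧ Literature.Analysis.FluidPDE.Torus.euclidDist ((Φ N).flow 0 z i).1 x₀ < h ∧ Literature.Analysis.FluidPDE.Torus.euclidDist ((Φ N).flow 0 z j).1 x₀ < h then Real.pi * (Literature.MathematicalPhysics.KineticTheory.hsDiameter σ N) ^ 2 * ‖((Φ N).flow 0 z i).2 - ((Φ N).flow 0 z j).2‖ * w N * ((Literature.MathematicalPhysics.KineticTheory.hsCompressibility (nl N z * σ ^ 3) - 1) / (2 * Real.pi / 3 * (nl N z * σ ^ 3))) / (4 / 3 * Real.pi * h ^ 3) else 0; Filter.Tendsto (fun N : ℕ => Literature.MathematicalPhysics.KineticTheory.localGibbsLaw σ a₀ u₀ θ₀ N (Φ N) {z | δ * Sc N z 1 * Sr N z 1 < |Sc N z F * Sr N z 1 - Sr N z F * Sc N z 1|}) Filter.atTop (nhds 0) ∧ Filter.Tendsto (fun N : ℕ => Literature.MathematicalPhysics.KineticTheory.localGibbsLaw σ a₀ u₀ θ₀ N (Φ N) {z | δ * Pr N z < |Sc N z 1 - Pr N z|}) Filter.atTop (nhds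 0)

/-- **SEL/ANG rigidity — ring-normality certifies velocity–angle chaos, cellwise** (CGW-type
certificate for time-ordered collision forests, local form with a modulus): at every `t ∈ (0, T)`
and accuracy `δ > 0` there is a ring tolerance `κ > 0` such that, whenever on all cells `B(x₀, h)`,
`h < h₁`, the window `M`-ring count stays within `κ · Z_coll` of `r_E(N) · Z_coll` in probability
(for every comparison flow family `Ψ`; verbatim the local conclusion of `RingDensityLaw` at
tolerance `κ`), then on all sufficiently small cells the SEL/ANG clause of `ContactChaos` holds at
accuracy `δ`. -/
def SelAngRigidity : Prop :=
  ∃ η₀ : ℝ, 0 < η₀ ∧ ∀ (a₀ θ₀ : UnitAddTorus (Fin 3) → ℝ) (u₀ : UnitAddTorus (Fin 3) → EuclideanSpace ℝ (Fin 3)), Continuous a₀ → Continuous θ₀ → Continuous u₀ → (∀ x, 0 < a₀ x) → (∀ x, 0 < θ₀ x) → ∃ σ₀ : ℝ, 0 < σ₀ ∧ ∀ σ : ℝ, 0 < σ → σ < σ₀ → ∀ M : ℝ, 0 < M → ∀ (T : ℝ) (ρ θ : ℝ → UnitAddTorus (Fin 3) → ℝ) (u : ℝ → UnitAddTorus (Fin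 3) → EuclideanSpace ℝ (Fin 3)), Literature.MathematicalPhysics.KineticTheory.IsHardSphereEulerSolution σ T ρ u θ → (∀ t ∈ Set.Ico 0 T, ∀ x, ρ t x * σ ^ 3 < η₀) → ∀ Φ : (N : ℕ) → Literature.Analysis.FluidPDE.HardSphereFlow (Literature.Analysis.FluidPDE.Torus.geometry (Fin 3)) (Literature.MathematicalPhysics.KineticTheory.hsDiameter σ N) (N + 1), Literature.MathematicalPhysics.KineticTheory.TendstoHydroFieldsAt (fun N => Literature.MathematicalPhysics.KineticTheory.localGibbsLaw σ a₀ u₀ θ₀ N (Φ N)) Φ ρ u θ 0 → ∀ t ∈ Set.Ioo 0 T, ∀ δ : ℝ, 0 < δ → ∃ κ : ℝ, 0 < κ ∧ ∀ h₁ : ℝ, 0 < h₁ → (∀ h : ℝ, 0 < h → h < h₁ → ∀ x₀ : UnitAddTorus (Fin 3), ∀ Ψ : (N : ℕ) → Literature.Analysis.FluidPDE.HardSphereFlow (Literature.Analysis.FluidPDE.Torus.geometry (Fin 3)) (Literature.MathematicalPhysics.KineticTheory.hsDiameter (σ * ρ t x₀ ^ (1 / 3 : ℝ)) N) (N + 1),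 let w : ℕ → ℝ := fun N => M / (σ ^ 2 * (ρ t x₀ * Real.sqrt (θ t x₀) * ((N + 1 : ℕ) : ℝ) ^ (1 / 3 : ℝ))); let w' : ℕ → ℝ := fun N => M / ((σ * ρ t x₀ ^ (1 / 3 : ℝ)) ^ 2 * (Real.sqrt (θ t x₀) * ((N + 1 : ℕ) : ℝ) ^ (1 / 3 : ℝ))); let Tc := fun (N : ℕ) (ε : ℝ) (γ : ℝ → Literature.Analysis.FluidPDE.Config (N + 1) (Fin 3) (UnitAddTorus (Fin 3))) (a ℓ r : ℝ) (i j : Fin (N + 1)) => {s : ℝ | s ∈ Set.Icc a (a + ℓ) ∧ γ s ∈ Literature.Analysis.FluidPDE.contactSet (Literature.Analysis.FluidPDE.Torus.geometry (Fin 3)) (N + 1) ε i j ∧ Literature.Analysis.FluidPDE.Torus.euclidDist (γ s i).1 x₀ < r}; let Bc := fun (N : ℕ) (ε : ℝ) (γ : ℝ → Literature.Analysis.FluidPDE.Config (N + 1) (Fin 3) (UnitAddTorus (Fin 3))) (a b : ℝ) (i : Fin (N + 1)) => {k : Fin (N + 1) | ∃ (m : ℕ) (p : Fin (m + 1) → Fin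 (N + 1)) (τ : Fin m → ℝ), p 0 = i ∧ p (Fin.last m) = k ∧ StrictAnti τ ∧ ∀ l : Fin m, τ l ∈ Set.Ico a b ∧ γ (τ l) ∈ Literature.Analysis.FluidPDE.contactSet (Literature.Analysis.FluidPDE.Torus.geometry (Fin 3)) (N + 1) ε (p l.castSucc) (p l.succ)}; let Zc := fun (N : ℕ) (ε : ℝ) (γ : ℝ → Literature.Analysis.FluidPDE.Config (N + 1) (Fin 3) (UnitAddTorus (Fin 3))) (a ℓ r : ℝ) => ∑ i : Fin (N + 1), ∑ j : Fin (N + 1), if i ≠ j then ∑ᶠ s ∈ Tc N ε γ a ℓ r i j, (1 : ℝ) else 0; let Zr := fun (N : ℕ) (ε : ℝ) (γ : ℝ → Literature.Analysis.FluidPDE.Config (N + 1) (Fin 3) (UnitAddTorus (Fin 3))) (a ℓ r : ℝ) => ∑ i : Fin (N + 1), ∑ j : Fin (N + 1), if i ≠ j then ∑ᶠ s ∈ Tc N ε γ a ℓ r i j, Set.indicator {s' : ℝ | ∃ k, k ∈ Bc N ε γ (s' - ℓ) s' i ∧ k ∈ Bc N ε γ (s' - ℓ) s' j} 1 s else 0;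 let rE : ℕ → ℝ := fun N => (∫ z, Zr N (Literature.MathematicalPhysics.KineticTheory.hsDiameter (σ * ρ t x₀ ^ (1 / 3 : ℝ)) N) (fun s => (Ψ N).flow s z) 0 (w' N) 2 ∂Literature.MathematicalPhysics.KineticTheory.localGibbsLaw (σ * ρ t x₀ ^ (1 / 3 : ℝ)) 1 0 (fun _ => θ t x₀) N (Ψ N)) / (∫ z, Zc N (Literature.MathematicalPhysics.KineticTheory.hsDiameter (σ * ρ t x₀ ^ (1 / 3 : ℝ)) N) (fun s => (Ψ N).flow s z) 0 (w' N) 2 ∂Literature.MathematicalPhysics.KineticTheory.localGibbsLaw (σ * ρ t x₀ ^ (1 / 3 : ℝ)) 1 0 (fun _ => θ t x₀) N (Ψ N)); Filter.Tendsto (fun N : ℕ => Literature.MathematicalPhysics.KineticTheory.localGibbsLaw σ a₀ u₀ θ₀ N (Φ N) {z | κ * Zc N (Literature.MathematicalPhysics.KineticTheory.hsDiameter σ N) (fun s => (Φ N).flow s z) t (w N) h < |Zr N (Literature.MathematicalPhysics.KineticTheory.hsDiameter σ N) (fun s => (Φ N).flow s z) t (w N) h - rE N * Zc N (Literature.MathematicalPhysics.KineticTheory.hsDiameter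 σ N) (fun s => (Φ N).flow s z) t (w N) h|}) Filter.atTop (nhds 0)) → ∃ h₀ : ℝ, 0 < h₀ ∧ ∀ h : ℝ, 0 < h → h < h₀ → ∀ x₀ : UnitAddTorus (Fin 3), ∀ F : EuclideanSpace ℝ (Fin 3) → EuclideanSpace ℝ (Fin 3) → EuclideanSpace ℝ (Fin 3) → ℝ, Continuous (fun p : EuclideanSpace ℝ (Fin 3) × EuclideanSpace ℝ (Fin 3) × EuclideanSpace ℝ (Fin 3) => F p.1 p.2.1 p.2.2) → (∀ v v' ω, |F v v' ω| ≤ 1) → let w : ℕ → ℝ := fun N => M / (σ ^ 2 * (ρ t x₀ * Real.sqrt (θ t x₀) * ((N + 1 : ℕ) : ℝ) ^ (1 / 3 : ℝ))); let Sc := fun (N : ℕ) (z : Literature.Analysis.FluidPDE.Config (N + 1) (Fin 3) (UnitAddTorus (Fin 3))) (E : EuclideanSpace ℝ (Fin 3) → EuclideanSpace ℝ (Fin 3) → EuclideanSpace ℝ (Fin 3) → ℝ) => ∑ i : Fin (N + 1), ∑ j : Fin (N + 1), if i ≠ j then ∑ᶠ s ∈ {s : ℝ | s ∈ Set.Icc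 t (t + w N) ∧ (Φ N).flow s z ∈ Literature.Analysis.FluidPDE.contactSet (Literature.Analysis.FluidPDE.Torus.geometry (Fin 3)) (N + 1) (Literature.MathematicalPhysics.KineticTheory.hsDiameter σ N) i j ∧ Literature.Analysis.FluidPDE.Torus.euclidDist ((Φ N).flow s z i).1 x₀ < h}, E (Function.leftLim (fun s => (Φ N).flow s z) s i).2 (Function.leftLim (fun s => (Φ N).flow s z) s j).2 ((Literature.MathematicalPhysics.KineticTheory.hsDiameter σ N)⁻¹ • (Literature.Analysis.FluidPDE.Torus.geometry (Fin 3)).sepVec ((Φ N).flow s z i).1 ((Φ N).flow s z j).1) else 0; let Sr := fun (N : ℕ) (z : Literature.Analysis.FluidPDE.Config (N + 1) (Fin 3) (UnitAddTorus (Fin 3))) (E : EuclideanSpace ℝ (Fin 3) → EuclideanSpace ℝ (Fin 3) → EuclideanSpace ℝ (Fin 3) → ℝ) => ∑ i : Fin (N + 1), ∑ j : Fin (N + 1), if i ≠ j ∧ Literature.Analysis.FluidPDE.Torus.euclidDist ((Φ N).flow t z i).1 x₀ < h ∧ Literature.Analysis.FluidPDE.Torus.euclidDist ((Φ N).flow t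 z j).1 x₀ < h then ∫ y : EuclideanSpace ℝ (Fin 3), E ((Φ N).flow t z i).2 ((Φ N).flow t z j).2 (‖y‖⁻¹ • y) * max 0 (-(inner ℝ (((Φ N).flow t z i).2 - ((Φ N).flow t z j).2) y)) * Real.exp (-‖y‖ ^ 2) else 0; Filter.Tendsto (fun N : ℕ => Literature.MathematicalPhysics.KineticTheory.localGibbsLaw σ a₀ u₀ θ₀ N (Φ N) {z | δ * Sc N z 1 * Sr N z 1 < |Sc N z F * Sr N z 1 - Sr N z F * Sc N z 1|}) Filter.atTop (nhds 0)

/-- **RATE rigidity — ring-normality certifies the Enskog collision frequency, cellwise**: the same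
local certificate shape as `SelAngRigidity`, concluding the RATE clause of `ContactChaos` (ordered
collision count within a factor `δ` of the Enskog prediction with the local-equilibrium contact
factor `g_E(n_cell σ³) = (Z − 1)/((2π/3) n_cell σ³)`, `Z = hsCompressibility`). -/
def RateRigidity : Prop :=
  ∃ η₀ : ℝ, 0 < η₀ ∧ ∀ (a₀ θ₀ : UnitAddTorus (Fin 3) → ℝ) (u₀ : UnitAddTorus (Fin 3) → EuclideanSpace ℝ (Fin 3)), Continuous a₀ → Continuous θ₀ → Continuous u₀ → (∀ x, 0 < a₀ x) → (∀ x, 0 < θ₀ x) → ∃ σ₀ : ℝ, 0 < σ₀ ∧ ∀ σ : ℝ, 0 < σ → σ < σ₀ → ∀ M : ℝ, 0 < M → ∀ (T : ℝ) (ρ θ : ℝ → UnitAddTorus (Fin 3) → ℝ) (u : ℝ → UnitAddTorus (Fin 3) → EuclideanSpace ℝ (Fin 3)), Literature.MathematicalPhysics.KineticTheory.IsHardSphereEulerSolution σ T ρ u θ → (∀ t ∈ Set.Ico 0 T, ∀ x, ρ t x * σ ^ 3 < η₀) → ∀ Φ : (N : ℕ) → Literature.Analysis.FluidPDE.HardSphereFlow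 (Literature.Analysis.FluidPDE.Torus.geometry (Fin 3)) (Literature.MathematicalPhysics.KineticTheory.hsDiameter σ N) (N + 1), Literature.MathematicalPhysics.KineticTheory.TendstoHydroFieldsAt (fun N => Literature.MathematicalPhysics.KineticTheory.localGibbsLaw σ a₀ u₀ θ₀ N (Φ N)) Φ ρ u θ 0 → ∀ t ∈ Set.Ioo 0 T, ∀ δ : ℝ, 0 < δ → ∃ κ : ℝ, 0 < κ ∧ ∀ h₁ : ℝ, 0 < h₁ → (∀ h : ℝ, 0 < h → h < h₁ → ∀ x₀ : UnitAddTorus (Fin 3), ∀ Ψ : (N : ℕ) → Literature.Analysis.FluidPDE.HardSphereFlow (Literature.Analysis.FluidPDE.Torus.geometry (Fin 3)) (Literature.MathematicalPhysics.KineticTheory.hsDiameter (σ * ρ t x₀ ^ (1 / 3 : ℝ)) N) (N + 1), let w : ℕ → ℝ := fun N => M / (σ ^ 2 * (ρ t x₀ * Real.sqrt (θ t x₀) * ((N + 1 : ℕ) : ℝ) ^ (1 / 3 : ℝ))); let w' : ℕ → ℝ := fun N => M / ((σ * ρ t x₀ ^ (1 / 3 : ℝ)) ^ 2 * (Real.sqrt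 (θ t x₀) * ((N + 1 : ℕ) : ℝ) ^ (1 / 3 : ℝ))); let Tc := fun (N : ℕ) (ε : ℝ) (γ : ℝ → Literature.Analysis.FluidPDE.Config (N + 1) (Fin 3) (UnitAddTorus (Fin 3))) (a ℓ r : ℝ) (i j : Fin (N + 1)) => {s : ℝ | s ∈ Set.Icc a (a + ℓ) ∧ γ s ∈ Literature.Analysis.FluidPDE.contactSet (Literature.Analysis.FluidPDE.Torus.geometry (Fin 3)) (N + 1) ε i j ∧ Literature.Analysis.FluidPDE.Torus.euclidDist (γ s i).1 x₀ < r}; let Bc := fun (N : ℕ) (ε : ℝ) (γ : ℝ → Literature.Analysis.FluidPDE.Config (N + 1) (Fin 3) (UnitAddTorus (Fin 3))) (a b : ℝ) (i : Fin (N + 1)) => {k : Fin (N + 1) | ∃ (m : ℕ) (p : Fin (m + 1) → Fin (N + 1)) (τ : Fin m → ℝ), p 0 = i ∧ p (Fin.last m) = k ∧ StrictAnti τ ∧ ∀ l : Fin m, τ l ∈ Set.Ico a b ∧ γ (τ l) ∈ Literature.Analysis.FluidPDE.contactSet (Literature.Analysis.FluidPDE.Torus.geometry (Fin 3)) (N +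 1) ε (p l.castSucc) (p l.succ)}; let Zc := fun (N : ℕ) (ε : ℝ) (γ : ℝ → Literature.Analysis.FluidPDE.Config (N + 1) (Fin 3) (UnitAddTorus (Fin 3))) (a ℓ r : ℝ) => ∑ i : Fin (N + 1), ∑ j : Fin (N + 1), if i ≠ j then ∑ᶠ s ∈ Tc N ε γ a ℓ r i j, (1 : ℝ) else 0; let Zr := fun (N : ℕ) (ε : ℝ) (γ : ℝ → Literature.Analysis.FluidPDE.Config (N + 1) (Fin 3) (UnitAddTorus (Fin 3))) (a ℓ r : ℝ) => ∑ i : Fin (N + 1), ∑ j : Fin (N + 1), if i ≠ j then ∑ᶠ s ∈ Tc N ε γ a ℓ r i j, Set.indicator {s' : ℝ | ∃ k, k ∈ Bc N ε γ (s' - ℓ) s' i ∧ k ∈ Bc N ε γ (s' - ℓ) s' j} 1 s else 0; let rE : ℕ → ℝ := fun N => (∫ z, Zr N (Literature.MathematicalPhysics.KineticTheory.hsDiameter (σ * ρ t x₀ ^ (1 / 3 : ℝ)) N) (fun s => (Ψ N).flow s z) 0 (w' N) 2 ∂Literature.MathematicalPhysics.KineticTheory.localGibbsLaw (σ * ρ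 t x₀ ^ (1 / 3 : ℝ)) 1 0 (fun _ => θ t x₀) N (Ψ N)) / (∫ z, Zc N (Literature.MathematicalPhysics.KineticTheory.hsDiameter (σ * ρ t x₀ ^ (1 / 3 : ℝ)) N) (fun s => (Ψ N).flow s z) 0 (w' N) 2 ∂Literature.MathematicalPhysics.KineticTheory.localGibbsLaw (σ * ρ t x₀ ^ (1 / 3 : ℝ)) 1 0 (fun _ => θ t x₀) N (Ψ N)); Filter.Tendsto (fun N : ℕ => Literature.MathematicalPhysics.KineticTheory.localGibbsLaw σ a₀ u₀ θ₀ N (Φ N) {z | κ * Zc N (Literature.MathematicalPhysics.KineticTheory.hsDiameter σ N) (fun s => (Φ N).flow s z) t (w N) h < |Zr N (Literature.MathematicalPhysics.KineticTheory.hsDiameter σ N) (fun s => (Φ N).flow s z) t (w N) h - rE N * Zc N (Literature.MathematicalPhysics.KineticTheory.hsDiameter σ N) (fun s => (Φ N).flow s z) t (w N) h|}) Filter.atTop (nhds 0)) → ∃ h₀ : ℝ, 0 < h₀ ∧ ∀ h : ℝ, 0 < h → h < h₀ → ∀ x₀ : UnitAddTorus (Fin 3), let w : ℕ → ℝ :=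 fun N => M / (σ ^ 2 * (ρ t x₀ * Real.sqrt (θ t x₀) * ((N + 1 : ℕ) : ℝ) ^ (1 / 3 : ℝ))); let Sc := fun (N : ℕ) (z : Literature.Analysis.FluidPDE.Config (N + 1) (Fin 3) (UnitAddTorus (Fin 3))) (E : EuclideanSpace ℝ (Fin 3) → EuclideanSpace ℝ (Fin 3) → EuclideanSpace ℝ (Fin 3) → ℝ) => ∑ i : Fin (N + 1), ∑ j : Fin (N + 1), if i ≠ j then ∑ᶠ s ∈ {s : ℝ | s ∈ Set.Icc t (t + w N) ∧ (Φ N).flow s z ∈ Literature.Analysis.FluidPDE.contactSet (Literature.Analysis.FluidPDE.Torus.geometry (Fin 3)) (N + 1) (Literature.MathematicalPhysics.KineticTheory.hsDiameter σ N) i j ∧ Literature.Analysis.FluidPDE.Torus.euclidDist ((Φ N).flow s z i).1 x₀ < h}, E (Function.leftLim (fun s => (Φ N).flow s z) s i).2 (Function.leftLim (fun s => (Φ N).flow s z) s j).2 ((Literature.MathematicalPhysics.KineticTheory.hsDiameter σ N)⁻¹ • (Literature.Analysis.FluidPDE.Torus.geometry (Fin 3)).sepVec ((Φ N).flow s z i).1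 ((Φ N).flow s z j).1) else 0; let nl := fun (N : ℕ) (z : Literature.Analysis.FluidPDE.Config (N + 1) (Fin 3) (UnitAddTorus (Fin 3))) => (∑ i : Fin (N + 1), if Literature.Analysis.FluidPDE.Torus.euclidDist ((Φ N).flow t z i).1 x₀ < h then (1 : ℝ) else 0) / ((N + 1 : ℝ) * (4 / 3 * Real.pi * h ^ 3)); let Pr := fun (N : ℕ) (z : Literature.Analysis.FluidPDE.Config (N + 1) (Fin 3) (UnitAddTorus (Fin 3))) => ∑ i : Fin (N + 1), ∑ j : Fin (N + 1), if i ≠ j ∧ Literature.Analysis.FluidPDE.Torus.euclidDist ((Φ N).flow t z i).1 x₀ < h ∧ Literature.Analysis.FluidPDE.Torus.euclidDist ((Φ N).flow t z j).1 x₀ < h then Real.pi * (Literature.MathematicalPhysics.KineticTheory.hsDiameter σ N) ^ 2 * ‖((Φ N).flow t z i).2 - ((Φ N).flow t z j).2‖ * w N * ((Literature.MathematicalPhysics.KineticTheory.hsCompressibility (nl N z * σ ^ 3) - 1) / (2 * Real.pi / 3 * (nl N z * σ ^ 3))) / (4 / 3 * Real.pi * h ^ 3) else 0; Filter.Tendsto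 (fun N : ℕ => Literature.MathematicalPhysics.KineticTheory.localGibbsLaw σ a₀ u₀ θ₀ N (Φ N) {z | δ * Pr N z < |Sc N z 1 - Pr N z|}) Filter.atTop (nhds 0)

/-- **Stub S1** — initial-layer chaos from local Gibbs data (size L; equilibrium technology:
near-invariance of the local Gibbs law over a microscopic window, Bogolyubov's identity for the
collision measure, contact-value theorem for the RATE clause, cellwise LLN).
Sources: Bogolyubov1975; VanbeijerenErnst1973; Resibois1978; Lutsko1996. -/
theorem stub_initialLayerChaos : InitialLayerChaos := by
  sorry

/-- **Stub S2** (HARDEST) — in the sparse regime, local ring-normality forces the SEL/ANG clause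
(ancestry lemma for fresh collisions + "excess correlation forces excess/deficient rings";
ChungGrahamWilson1989 Thm 1 analogue, sparse form ChungGraham2002, oriented doi:10.1002/jgt.21701;
backward clusters AokiEtAl2015 §1).  Why it might fail: a velocity-correlated, ring-normal state
(shear-aligned pairs) makes the certificate blind. -/
theorem stub_selAngRigidity : RingSparsity → SelAngRigidity := by
  sorry

/-- **Stub S3** — in the sparse regime, local ring-normality forces the RATE clause (contact value
of the pair correlation equals `g_E` of the empirical cell packing; rings probe the three-body
re-aiming structure that moves `g(σ⁺)`).  Sources: VanbeijerenErnst1973; Resibois1978; Dorfman1999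
§16; Lutsko1996. -/
theorem stub_rateRigidity : RingSparsity → RateRigidity := by
  sorry

/-- **Composition, implication form** (the real proof; no `sorry`, axioms `propext`,
`Classical.choice`, `Quot.sound` only): the three stub STATEMENTS imply the crux.  The conclusion is
spelled `RingSparsity → RingDensityLaw → ContactChaos`, i.e. `RingCertificate` unfolded (definitionally
equal), so that the registered skeleton theorem concluding the crux BY NAME is the hypothesis-free
`RingCertificate_of` below (the skeleton audit admits as hypotheses only registered obligations). -/
theorem RingCertificate_of_stubs :
    InitialLayerChaos → (RingSparsity → SelAngRigidity) → (RingSparsity → RateRigidity) →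
      RingSparsity → RingDensityLaw → ContactChaos := by
  intro h₁ h₂ h₃ hS hR
  obtain ⟨η₁, hη₁, H₁⟩ := h₁
  obtain ⟨η₂, hη₂, H₂⟩ := h₂ hS
  obtain ⟨η₃, hη₃, H₃⟩ := h₃ hS
  obtain ⟨η₄, hη₄, H₄⟩ := hR
  refine ⟨min (min η₁ η₂) (min η₃ η₄), lt_min (lt_min hη₁ hη₂) (lt_min hη₃ hη₄), ?_⟩
  intro a₀ θ₀ u₀ ha hθ hu hap hθp
  obtain ⟨σ₁, hσ₁, K₁⟩ := H₁ a₀ θ₀ u₀ ha hθ hu hap hθp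
  obtain ⟨σ₂, hσ₂, K₂⟩ := H₂ a₀ θ₀ u₀ ha hθ hu hap hθp
  obtain ⟨σ₃, hσ₃, K₃⟩ := H₃ a₀ θ₀ u₀ ha hθ hu hap hθp
  obtain ⟨σ₄, hσ₄, K₄⟩ := H₄ a₀ θ₀ u₀ ha hθ hu hap hθp
  refine ⟨min (min σ₁ σ₂) (min σ₃ σ₄), lt_min (lt_min hσ₁ hσ₂) (lt_min hσ₃ hσ₄), ?_⟩
  intro σ hσ hσlt M hM T ρ θ u hE hband Φ hLLN t ht δ hδ
  -- the packing band at the minimum threshold implies each supplier's band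
  have band : ∀ η : ℝ, min (min η₁ η₂) (min η₃ η₄) ≤ η →
      ∀ s ∈ Set.Ico 0 T, ∀ x, ρ s x * σ ^ 3 < η :=
    fun η hle s hs x => lt_of_lt_of_le (hband s hs x) hle
  have hb₁ := band η₁ ((min_le_left _ _).trans (min_le_left _ _))
  have hb₂ := band η₂ ((min_le_left _ _).trans (min_le_right _ _))
  have hb₃ := band η₃ ((min_le_right _ _).trans (min_le_left _ _))
  have hb₄ := band η₄ ((min_le_right _ _).trans (min_le_right _ _))
  have hs₁ : σ < σ₁ := lt_of_lt_of_le hσlt ((min_le_left _ _).trans (min_le_left _ _))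
  have hs₂ : σ < σ₂ := lt_of_lt_of_le hσlt ((min_le_left _ _).trans (min_le_right _ _))
  have hs₃ : σ < σ₃ := lt_of_lt_of_le hσlt ((min_le_right _ _).trans (min_le_left _ _))
  have hs₄ : σ < σ₄ := lt_of_lt_of_le hσlt ((min_le_right _ _).trans (min_le_right _ _))
  rcases eq_or_lt_of_le ht.1 with h0 | htpos
  · -- initial layer `t = 0`: stub S1 (its window `[0, w_N]` is `[0, 0 + w_N]` after `zero_add`)
    subst h0
    have K := K₁ σ hσ hs₁ M hM T ρ θ u hE hb₁ Φ hLLN ht.2 δ hδ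
    simpa only [zero_add] using K
  · -- positive times: feed the local conclusion of `RingDensityLaw` into the two rigidity stubs
    have ht' : t ∈ Set.Ioo 0 T := ⟨htpos, ht.2⟩
    obtain ⟨κ₂, hκ₂, L₂⟩ := K₂ σ hσ hs₂ M hM T ρ θ u hE hb₂ Φ hLLN t ht' δ hδ
    obtain ⟨κ₃, hκ₃, L₃⟩ := K₃ σ hσ hs₃ M hM T ρ θ u hE hb₃ Φ hLLN t ht' δ hδ
    obtain ⟨g₂, hg₂, R₂⟩ := K₄ σ hσ hs₄ M hM T ρ θ u hE hb₄ Φ hLLN t ht' κ₂ hκ₂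
    obtain ⟨g₃, hg₃, R₃⟩ := K₄ σ hσ hs₄ M hM T ρ θ u hE hb₄ Φ hLLN t ht' κ₃ hκ₃
    obtain ⟨e₂, he₂, M₂⟩ := L₂ g₂ hg₂ R₂
    obtain ⟨e₃, he₃, M₃⟩ := L₃ g₃ hg₃ R₃
    refine ⟨min e₂ e₃, lt_min he₂ he₃, ?_⟩
    intro h hh hlt x₀ F hF hFb
    have A := M₂ h hh (lt_of_lt_of_le hlt (min_le_left _ _)) x₀ F hF hFb
    have B := M₃ h hh (lt_of_lt_of_le hlt (min_le_right _ _)) x₀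
    exact ⟨A, B⟩

/-- **The skeleton theorem** (registered; concludes the route decl
`Summit.AtomisticToContinuum.HydrodynamicLimit.Theses.RingDensityCertificate.RingCertificate` BY NAME,
no `sorry` of its own — its only `sorryAx` dependence is through the three declared stubs):
`RingCertificate_of_stubs` applied to `stub_initialLayerChaos`, `stub_selAngRigidity`,
`stub_rateRigidity`. -/
theorem RingCertificate_of : RingCertificate :=
  RingCertificate_of_stubs stub_initialLayerChaos stub_selAngRigidity stub_rateRigidity

end Summit.AtomisticToContinuum.HydrodynamicLimit.Cruxes.RingCertificate.Birth
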